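import Summits.CriticalPhenomena.PercolationContinuityZ3.Theses.PercNearOneGluing
import Literature.Probability.Percolation.PercolationProofs
import Literature.Probability.Percolation.ConditionalPositiveAssociationProofs
import Literature.Probability.Percolation.TwoClusterConditionalAssociationProofs
import Summits.CriticalPhenomena.PercolationContinuityZ3.Theorems.PercNearOneGluingAdditiveGluingGoodTwoRelays

/-! TTRL-lite variant V2080 of stmt-CriticalPhenomena-4576

(`stub_goodStep`, move `specialise+small_case`: `n := 6` and `A.card ≤ 2`).  With at most two
relays the additive gluing good step is the plain union bound: every bad event lies inside
`{a ↮ b}` for the unique relay `a ≠ b` (or is empty when `A = {b}`), which is exactly the proved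
two-relay case `stub_goodStepTwoRelays_k41` (`A.card ≤ 3`); neither the low-neighbour hypothesis
nor the induction hypothesis is needed.  No new definitions, no named facts. -/

namespace Summit.CriticalPhenomena.PercolationContinuityZ3.Theorems

open MeasureTheory Literature.Probability.LatticeModels Literature.Probability.Percolation
open scoped Classical BigOperators

/-- TTRL-lite variant V2080 of `stub_goodStep` (stmt-CriticalPhenomena-4576): the inductive step of
the good-quadruple inequality on six vertices with a relay set of at most two elements.  Since
`A.card ≤ 2 ≤ 3`, this is a special case of the proved two-relay good step
`stub_goodStepTwoRelays_k41`; the low-neighbour and induction hypotheses are discarded. -/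
theorem stub_goodStep_var2080 : ∀ (w : Sym2 (Fin 6) → unitInterval) (A : Finset (Fin 6)) (o b : Fin 6), A.card ≤ 2 → b ∈ A → o ∉ A → (∃ y : Fin 6, y ∉ A ∧ y ≠ o ∧ (w s(o, y) : ℝ) ≠ 0) → (∀ w' : Sym2 (Fin 6) → unitInterval, (Finset.univ.filter (fun v : Fin 6 => ∃ u : Fin 6, 0 < (w' s(u, v) : ℝ))).card < (Finset.univ.filter (fun v : Fin 6 => ∃ u : Fin 6, 0 < (w s(u, v) : ℝ))).card → ∀ (A' : Finset (Fin 6)) (o' b' : Fin 6), b' ∈ A' → o' ∉ A' → ∀ (t : ℝ) (sel : Finset (Fin 6) → Fin 6), (∀ W, sel W ∈ A') → (∀ a ∈ A', 1 - t ≤ (prodBernoulli w').real (openConn a b')) → (prodBernoulli w').real ((⋃ a ∈ A', openConn o' a) ∩ (openConn o' b')ᶜ) + ∑ W ∈ (Finset.univ : Finset (Finset (Fin 6))).filter (fun W => o' ∈ W ∧ Disjoint W A'), (prodBernoulli w').real {ω : BondConfig (Fin 6) | openCluster ω o' = (W : Set (Fin 6))} * (prodBernoulli w').real (openConnIn ((W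 : Set (Fin 6))ᶜ) (sel W) b')ᶜ ≤ t) → ∀ (t : ℝ) (sel : Finset (Fin 6) → Fin 6), (∀ W, sel W ∈ A) → (∀ a ∈ A, 1 - t ≤ (prodBernoulli w).real (openConn a b)) → (prodBernoulli w).real ((⋃ a ∈ A, openConn o a) ∩ (openConn o b)ᶜ) + ∑ W ∈ (Finset.univ : Finset (Finset (Fin 6))).filter (fun W => o ∈ W ∧ Disjoint W A), (prodBernoulli w).real {ω : BondConfig (Fin 6) | openCluster ω o = (W : Set (Fin 6))} * (prodBernoulli w).real (openConnIn ((W : Set (Fin 6))ᶜ) (sel W) b)ᶜ ≤ t := by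
  intro w A o b hcard hbA hoA _hy _hIH t sel hsel hlev
  exact stub_goodStepTwoRelays_k41 6 w A o b hbA hoA (le_trans hcard (by norm_num)) t sel hsel hlev

end Summit.CriticalPhenomena.PercolationContinuityZ3.Theorems
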